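import Mathlib
import Summits.ValiantsHypothesis.ValiantsHypothesis.Theorems.DivisionGapPerCofactorDegreeReductionStubAdditiveCreation
import Summits.ValiantsHypothesis.ValiantsHypothesis.Theorems.ZeroOneTransfer.Negative.TopComponentFree
import Literature.Computability.AlgebraicComplexity.ArithCircuitProofs
import Literature.Computability.AlgebraicComplexity.PermanentIrreducible
import Literature.Computability.AlgebraicComplexity.StandardFamiliesProofs

/-!
# Crux `DivisionGap.PerCofactorDegreeReduction` (stmt-ValiantsHypothesis-15046), line `Sketch` —
# stub `stub_additiveCreationHomogeneous`: the prime walk in a PRUNED circuit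

**Theorem (`stub_additiveCreationHomogeneous`).** Let `n ≥ 2`, let `ws` be a finite list of
weights `w : (Fin n × Fin n) → ℕ` on the variables and let `g ∈ ℝ≥0[x_ij]` be nonzero,
`w`-weighted-homogeneous for every `w ∈ ws`, with `per_n ∣ g` read over `ℝ`.  Then the additive
creation data of `AdditiveCreation.stub_additiveCreation` — `c₁, c₂ ∈ ℝ≥0[x]`, weights
`w₁, w₂ ∈ ℝ≥0` with `L(c₁), L(c₂), L(w₁c₁ + w₂c₂) ≤ L(g)`, `w₁c₁ + w₂c₂ ≠ 0`,
`deg (w₁c₁ + w₂c₂) ≤ deg g`, `per_n ∣ w₁c₁ + w₂c₂`, `per_n ∤ c₁`, `per_n ∤ c₂` over `ℝ` — can be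
taken `w`-weighted-homogeneous for every `w ∈ ws` as well (all three of `c₁`, `c₂`,
`w₁c₁ + w₂c₂`, each in the robust form `IsWeightedHomogeneous w p (weightedTotalDegree w p)`,
which holds for `0` and pins the degree otherwise).

## Proof

Homogeneity of gate values is free over `ℝ≥0`.  Starting from a minimal fan-in-two circuit for
`g` (`ArithCircuit.exists_computes_size_eq_complexity`), prune it successively along every
`w ∈ ws` with the tree's `ZeroOneTransfer.Negative.prune w`: the pruned circuit has the same size
(`size_prune`), stays fan-in-two (`isFanInTwo_prune`), computes `top_w g = g`
(`eval_prune`, `topComponent_eq_self_of_isWeightedHomogeneous`), and its gate values are the top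
`w`-components of the old gate values (`gateValues_pruneAux`), hence `w`-homogeneous
(`weightedHomogeneousComponent_isWeightedHomogeneous`) and still `w'`-homogeneous for the earlier
`w'` (`support_topComponent_subset`: a sub-sum of a `w'`-homogeneous polynomial is
`w'`-homogeneous).  So (`exists_pruned_circuit`) there is a minimal circuit `P` for `g` all of
whose gate values are `w`-homogeneous for all `w ∈ ws`; then every operand value of `P` against
every prefix of its gate values is so too (`operand_eval_take_hom`: variables and constants are
weighted-homogeneous, live references are gate values, junk references read `0`).  Finally the
prime walk `AdditiveCreation.walk` is re-run verbatim with an arbitrary predicate `Q` holding for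
all operand values threaded to its three outputs (`walkQ`): the creation data `c₁`, `c₂` are
operand values and `w₁c₁ + w₂c₂` is the value of the sum gate where the walk stops, itself an
operand value one horizon up.

Leans on the tree only: `AdditiveCreation.{walk (copied), perPoly_prime, descend_smul,
complexity_getD_gateValues_le, complexity_eval_take_le, map_toRealHom_ne_zero,
le_totalDegree_of_perPoly_dvd, totalDegree_le_totalDegree_smul_add}`,
`ZeroOneTransfer.Negative.{prune, eval_prune, size_prune, isFanInTwo_prune, gateValues_pruneAux,
topComponent_eq_self_of_isWeightedHomogeneous, support_topComponent_subset}`,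
`ArithCircuit.exists_computes_size_eq_complexity`, `getD_gateValues`, `getD_gateValues_eq_zero`,
`getD_take_gateValues`; Mathlib.  No definitions.
-/

noncomputable section

-- `Summit.ValiantsHypothesis.ValiantsHypothesis.…` is the tree's mandated single-conjunct layout
-- (Problem = Summit), so the duplicated namespace component is intended.
set_option linter.dupNamespace false

namespace Summit.ValiantsHypothesis.ValiantsHypothesis.Theorems.DivisionGap.PerCofactorDegreeReduction.AdditiveCreationHomogeneous

open MvPolynomial Literature.Computability.AlgebraicComplexity ArithCircuit
open Literature.Barriers.ValiantsHypothesis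
open Summit.ValiantsHypothesis.ValiantsHypothesis.Theorems.DivisionGap.PerCofactorDegreeReduction.AdditiveCreation
open Summit.ValiantsHypothesis.ValiantsHypothesis.Theorems.ZeroOneTransfer.Negative
open scoped NNReal

/-! ### Weighted homogeneity in the robust form `IsWeightedHomogeneous w p (weightedTotalDegree w p)` -/

section Homogeneity

variable {σ : Type*} (w : σ → ℕ)

/-- Robust form of weighted homogeneity: a `w`-homogeneous polynomial (of any weighted degree) is
`w`-homogeneous of weighted degree its own weighted total degree (`0` is homogeneous of every
degree; a nonzero homogeneous polynomial of degree `d` has weighted total degree `d`). [folklore] -/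
theorem isWeightedHomogeneous_weightedTotalDegree {p : MvPolynomial σ ℝ≥0} {d : ℕ}
    (hp : IsWeightedHomogeneous w p d) :
    IsWeightedHomogeneous w p (weightedTotalDegree w p) := by
  intro m hm
  refine le_antisymm (le_weightedTotalDegree w (mem_support_iff.mpr hm)) ?_
  refine Finset.sup_le fun m' hm' => ?_
  rw [hp (mem_support_iff.mp hm'), ← hp hm]

/-- Over any semiring: a polynomial whose support lies in that of a `w`-homogeneous polynomial of
weighted degree `d` is `w`-homogeneous of weighted degree `d`. [folklore] -/
theorem isWeightedHomogeneous_of_support_subset {p q : MvPolynomial σ ℝ≥0} {d : ℕ}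
    (hq : IsWeightedHomogeneous w q d) (h : p.support ⊆ q.support) :
    IsWeightedHomogeneous w p d :=
  fun _ hm => hq (mem_support_iff.mp (h (mem_support_iff.mpr hm)))

/-- The top `w`-component is `w`-homogeneous (robust form). [folklore] -/
theorem topComponent_isWeightedHomogeneous (p : MvPolynomial σ ℝ≥0) :
    IsWeightedHomogeneous w (topComponent w p) (weightedTotalDegree w (topComponent w p)) :=
  isWeightedHomogeneous_weightedTotalDegree w
    (weightedHomogeneousComponent_isWeightedHomogeneous (weightedTotalDegree w p) p)

/-- The top `w`-component of a `w'`-homogeneous polynomial is `w'`-homogeneous (robust form): it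
is a sub-sum (`support_topComponent_subset`). [folklore] -/
theorem topComponent_isWeightedHomogeneous_of (w' : σ → ℕ) {p : MvPolynomial σ ℝ≥0}
    (hp : IsWeightedHomogeneous w' p (weightedTotalDegree w' p)) :
    IsWeightedHomogeneous w' (topComponent w p) (weightedTotalDegree w' (topComponent w p)) :=
  isWeightedHomogeneous_weightedTotalDegree w'
    (isWeightedHomogeneous_of_support_subset w' hp (support_topComponent_subset w p))

end Homogeneity

/-! ### Pruned minimal circuits: every gate value is homogeneous for every listed weight -/

section Prune

variable {σ : Type*}

/-- **Homogeneity of gate values is free over `ℝ≥0`.**  If `g` is `w`-homogeneous for every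
weight `w` of the list `ws`, then some fan-in-two circuit of size exactly `L(g)` computes `g` and
has ALL its gate values `w`-homogeneous for every `w ∈ ws`: prune a minimal circuit successively
along each `w ∈ ws` (`prune w`: same size, fan-in two, output `top_w g = g`, gate values replaced
by their top `w`-components, which stay `w'`-homogeneous for the earlier `w'`). [folklore] -/
theorem exists_pruned_circuit [DecidableEq σ] (ws : List (σ → ℕ)) (g : MvPolynomial σ ℝ≥0)
    (hhom : ∀ w ∈ ws, IsWeightedHomogeneous w g (weightedTotalDegree w g)) :
    ∃ P : ArithCircuit ℝ≥0 σ, P.IsFanInTwo ∧ P.Computes g ∧ P.size = complexity g ∧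
      ∀ v ∈ gateValues P.gates, ∀ w ∈ ws, IsWeightedHomogeneous w v (weightedTotalDegree w v) := by
  induction ws with
  | nil =>
    obtain ⟨P, h2, hP, hsize⟩ := exists_computes_size_eq_complexity g
    exact ⟨P, h2, hP, hsize, fun v _ w hw => absurd hw List.not_mem_nil⟩
  | cons w ws ih =>
    obtain ⟨P, h2, hP, hsize, hH⟩ := ih fun w' hw' => hhom w' (List.mem_cons_of_mem w hw')
    refine ⟨prune w P, isFanInTwo_prune w h2, ?_, (size_prune w P).trans hsize, ?_⟩
    · show (prune w P).eval = g
      rw [eval_prune, show P.eval = g from hP]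
      exact topComponent_eq_self_of_isWeightedHomogeneous w (hhom w List.mem_cons_self)
    · intro v hv w' hw'
      have hv' : v ∈ gateValues (pruneAux w P.gates).1 := hv
      rw [gateValues_pruneAux, List.mem_map] at hv'
      obtain ⟨v₀, hv₀, rfl⟩ := hv'
      rcases List.mem_cons.mp hw' with rfl | hw''
      · exact topComponent_isWeightedHomogeneous w' v₀
      · exact topComponent_isWeightedHomogeneous_of w w' (hH v₀ hv₀ w' hw'')

/-- In a circuit all of whose gate values are `w`-homogeneous for every `w ∈ ws`, every operand
value against every prefix of the gate values is so too: variables and constants are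
weighted-homogeneous, a live reference reads a gate value, a junk reference reads `0`.
[folklore] -/
theorem operand_eval_take_hom (ws : List (σ → ℕ)) (P : ArithCircuit ℝ≥0 σ)
    (hH : ∀ v ∈ gateValues P.gates, ∀ w ∈ ws, IsWeightedHomogeneous w v (weightedTotalDegree w v))
    (j : ℕ) (u : Operand ℝ≥0 σ) :
    ∀ w ∈ ws, IsWeightedHomogeneous w (u.eval ((gateValues P.gates).take j))
      (weightedTotalDegree w (u.eval ((gateValues P.gates).take j))) := by
  intro w hw
  cases u with
  | var i => exact isWeightedHomogeneous_weightedTotalDegree w (isWeightedHomogeneous_X ℝ≥0 w i)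
  | const c => exact isWeightedHomogeneous_weightedTotalDegree w (isWeightedHomogeneous_C w c)
  | gate i =>
    rw [Operand.eval_gate, getD_take_gateValues]
    split_ifs with hij
    · rw [List.getD_eq_getElem?_getD]
      rcases h : (gateValues P.gates)[i]? with _ | v
      · exact isWeightedHomogeneous_zero _ _ _
      · exact hH v (List.mem_of_getElem? h) w hw
    · exact isWeightedHomogeneous_zero _ _ _

end Prune

/-! ### The walk, with an invariant of operand values threaded to its outputs -/

/-- **The prime walk with a threaded predicate** (verbatim copy of `AdditiveCreation.walk`,
strong induction on the horizon `w`).  In a fan-in-two circuit `P` over `ℝ≥0` (`n ≥ 2`) whose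
operand values against every prefix of the gate values all satisfy a predicate `Q`: if an operand
evaluated against the first `w` gate values has a nonzero value `v` with `per_n ∣ v` over `ℝ` and
`deg v ≤ d`, then below it there is an additive creation point `w₁c₁ + w₂c₂` (a sum-gate value
with both terms nonzero) with `per_n ∣ w₁c₁ + w₂c₂`, `per_n ∤ c₁`, `per_n ∤ c₂` over `ℝ`, all of
cost `≤ P.size`, `deg (w₁c₁ + w₂c₂) ≤ d`, and `Q c₁`, `Q c₂`, `Q (w₁c₁ + w₂c₂)` — the outputs
`c₁`, `c₂` are operand values and the sum is a gate value, read by a live reference. [folklore] -/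
theorem walkQ {n : ℕ} (hn : 2 ≤ n) (P : ArithCircuit ℝ≥0 (Fin n × Fin n)) (h2 : P.IsFanInTwo)
    (Q : MvPolynomial (Fin n × Fin n) ℝ≥0 → Prop)
    (hQ : ∀ (j : ℕ) (u : Operand ℝ≥0 (Fin n × Fin n)), Q (u.eval ((gateValues P.gates).take j)))
    (w : ℕ) :
    ∀ (u : Operand ℝ≥0 (Fin n × Fin n)) (d : ℕ),
      u.eval ((gateValues P.gates).take w) ≠ 0 →
      perPoly (Fin n) ℝ ∣ MvPolynomial.map NNReal.toRealHom (u.eval ((gateValues P.gates).take w)) →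
      (u.eval ((gateValues P.gates).take w)).totalDegree ≤ d →
      ∃ (c₁ c₂ : MvPolynomial (Fin n × Fin n) ℝ≥0) (w₁ w₂ : ℝ≥0),
        complexity c₁ ≤ P.size ∧ complexity c₂ ≤ P.size ∧
        complexity (w₁ • c₁ + w₂ • c₂) ≤ P.size ∧
        w₁ • c₁ + w₂ • c₂ ≠ 0 ∧ (w₁ • c₁ + w₂ • c₂).totalDegree ≤ d ∧
        perPoly (Fin n) ℝ ∣ MvPolynomial.map NNReal.toRealHom (w₁ • c₁ + w₂ • c₂) ∧
        ¬ perPoly (Fin n) ℝ ∣ MvPolynomial.map NNReal.toRealHom c₁ ∧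
        ¬ perPoly (Fin n) ℝ ∣ MvPolynomial.map NNReal.toRealHom c₂ ∧
        Q c₁ ∧ Q c₂ ∧ Q (w₁ • c₁ + w₂ • c₂) := by
  -- adapted from `AdditiveCreation.walk` (same tree, landed): the predicate `Q` is threaded.
  have hprime : Prime (perPoly (Fin n) ℝ) := perPoly_prime (by omega)
  induction w using Nat.strong_induction_on with
  | _ w ih =>
    intro u d hne hdvd hdeg
    cases u with
    | var e =>
      exfalso
      have h := le_totalDegree_of_perPoly_dvd (map_toRealHom_ne_zero hne) hdvd
      simp only [Operand.eval, map_X, totalDegree_X] at h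
      omega
    | const c =>
      exfalso
      have h := le_totalDegree_of_perPoly_dvd (map_toRealHom_ne_zero hne) hdvd
      simp only [Operand.eval, map_C, totalDegree_C] at h
      omega
    | gate j =>
      have hQv := hQ w (Operand.gate j)
      simp only [Operand.eval_gate, getD_take_gateValues] at hne hdvd hdeg hQv ⊢
      by_cases hjw : j < w
      · simp only [hjw, if_true] at hne hdvd hdeg hQv ⊢
        -- the gate at `j` exists (junk values are `0`)
        rcases hg : P.gates[j]? with _ | g
        · exact absurd (getD_gateValues_eq_zero hg) hne
        have hval := getD_gateValues hg
        have hcostv : complexity (g.eval ((gateValues P.gates).take j)) ≤ P.size :=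
          hval ▸ complexity_getD_gateValues_le P h2 j
        rw [hval] at hne hdvd hdeg hQv
        have hop := ih j hjw
        set vs := (gateValues P.gates).take j
        have hcost : ∀ u : Operand ℝ≥0 (Fin n × Fin n), complexity (u.eval vs) ≤ P.size :=
          fun u => complexity_eval_take_le P h2 j u
        have hQop : ∀ u : Operand ℝ≥0 (Fin n × Fin n), Q (u.eval vs) := fun u => hQ j u
        have hfan : g.fanIn ≤ 2 := h2 g (List.mem_of_getElem? hg)
        cases g with
        | sum args =>
          rcases args with _ | ⟨a, _ | ⟨b, _ | ⟨c, rest⟩⟩⟩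
          · -- empty sum `= 0`
            simp [Gate.eval] at hne
          · -- one term `a.1 • a.2`
            simp only [Gate.eval, List.map_cons, List.map_nil, List.sum_cons, List.sum_nil,
              add_zero] at hne hdvd hdeg
            obtain ⟨hc, hcd, hcdeg⟩ := descend_smul hne hdvd
            exact hop a.2 d hc hcd (hcdeg.trans hdeg)
          · -- two terms `a.1 • a.2 + b.1 • b.2`
            simp only [Gate.eval, List.map_cons, List.map_nil, List.sum_cons, List.sum_nil,
              add_zero] at hne hdvd hdeg hcostv hQv ⊢
            by_cases ha : a.1 • a.2.eval vs = 0
            · rw [ha, zero_add] at hne hdvd hdeg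
              obtain ⟨hc, hcd, hcdeg⟩ := descend_smul hne hdvd
              exact hop b.2 d hc hcd (hcdeg.trans hdeg)
            by_cases hb : b.1 • b.2.eval vs = 0
            · rw [hb, add_zero] at hne hdvd hdeg
              obtain ⟨hc, hcd, hcdeg⟩ := descend_smul hne hdvd
              exact hop a.2 d hc hcd (hcdeg.trans hdeg)
            -- both terms are nonzero
            have ha1 : a.1 ≠ 0 := fun h => ha (by rw [h, zero_smul])
            have ha2 : a.2.eval vs ≠ 0 := fun h => ha (by rw [h, smul_zero])
            have hb1 : b.1 ≠ 0 := fun h => hb (by rw [h, zero_smul])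
            have hb2 : b.2.eval vs ≠ 0 := fun h => hb (by rw [h, smul_zero])
            by_cases h₁ : perPoly (Fin n) ℝ ∣ MvPolynomial.map NNReal.toRealHom (a.2.eval vs)
            · exact hop a.2 d ha2 h₁
                ((totalDegree_le_totalDegree_smul_add ha1 _ _).trans hdeg)
            by_cases h₂ : perPoly (Fin n) ℝ ∣ MvPolynomial.map NNReal.toRealHom (b.2.eval vs)
            · refine hop b.2 d hb2 h₂ (le_trans ?_ hdeg)
              rw [add_comm]
              exact totalDegree_le_totalDegree_smul_add hb1 _ _
            -- the additive creation point
            exact ⟨a.2.eval vs, b.2.eval vs, a.1, b.1, hcost a.2, hcost b.2, hcostv, hne, hdeg,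
              hdvd, h₁, h₂, hQop a.2, hQop b.2, hQv⟩
          · -- fan-in `≥ 3` is excluded
            simp [Gate.fanIn, Gate.args] at hfan
        | prod args =>
          rcases args with _ | ⟨u₁, _ | ⟨u₂, _ | ⟨u₃, rest⟩⟩⟩
          · -- empty product `= 1`
            exfalso
            simp only [Gate.eval, List.map_nil, List.prod_nil] at hdvd
            have h := le_totalDegree_of_perPoly_dvd (map_toRealHom_ne_zero one_ne_zero) hdvd
            simp only [map_one, totalDegree_one] at h
            omega
          · -- unary product: its operand
            simp only [Gate.eval, List.map_cons, List.map_nil, List.prod_cons, List.prod_nil,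
              mul_one] at hne hdvd hdeg
            exact hop u₁ d hne hdvd hdeg
          · -- binary product: a prime divides a factor
            simp only [Gate.eval, List.map_cons, List.map_nil, List.prod_cons, List.prod_nil,
              mul_one] at hne hdvd hdeg
            have hne₁ : u₁.eval vs ≠ 0 := left_ne_zero_of_mul hne
            have hne₂ : u₂.eval vs ≠ 0 := right_ne_zero_of_mul hne
            have hdeg12 := totalDegree_mul_of_isDomain hne₁ hne₂
            rw [map_mul] at hdvd
            rcases hprime.dvd_or_dvd hdvd with hd | hd
            · exact hop u₁ d hne₁ hd (by omega)
            · exact hop u₂ d hne₂ hd (by omega)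
          · -- fan-in `≥ 3` is excluded
            simp [Gate.fanIn, Gate.args] at hfan
      · simp only [hjw, if_false] at hne
        exact absurd rfl hne

/-! ### The stub -/

/-- **stub_additiveCreationHomogeneous — the prime walk in a PRUNED circuit.**  As
`AdditiveCreation.stub_additiveCreation`, for a `g` that is weighted-homogeneous for every weight
of a finite list `ws` (in the line: total degree and the `2n` row/column margins): the creation
data `c₁`, `c₂`, `w₁c₁ + w₂c₂` may be taken weighted-homogeneous for every `w ∈ ws` as well.
Proof: run the walk (`walkQ`) in a minimal circuit pruned along each `w ∈ ws`
(`exists_pruned_circuit`), where every operand value is `w`-homogeneous for all `w ∈ ws`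
(`operand_eval_take_hom`), starting from the output operand (`P.eval = g`). [folklore] -/
theorem stub_additiveCreationHomogeneous (n : ℕ) (hn : 2 ≤ n)
    (ws : List (Fin n × Fin n → ℕ)) (g : MvPolynomial (Fin n × Fin n) ℝ≥0)
    (hg : g ≠ 0) (hhom : ∀ w ∈ ws, IsWeightedHomogeneous w g (weightedTotalDegree w g))
    (hdvd : perPoly (Fin n) ℝ ∣ MvPolynomial.map NNReal.toRealHom g) :
    ∃ (c₁ c₂ : MvPolynomial (Fin n × Fin n) ℝ≥0) (w₁ w₂ : ℝ≥0),
      complexity c₁ ≤ complexity g ∧ complexity c₂ ≤ complexity g ∧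
      complexity (w₁ • c₁ + w₂ • c₂) ≤ complexity g ∧
      w₁ • c₁ + w₂ • c₂ ≠ 0 ∧ (w₁ • c₁ + w₂ • c₂).totalDegree ≤ g.totalDegree ∧
      perPoly (Fin n) ℝ ∣ MvPolynomial.map NNReal.toRealHom (w₁ • c₁ + w₂ • c₂) ∧
      ¬ perPoly (Fin n) ℝ ∣ MvPolynomial.map NNReal.toRealHom c₁ ∧
      ¬ perPoly (Fin n) ℝ ∣ MvPolynomial.map NNReal.toRealHom c₂ ∧
      (∀ w ∈ ws, IsWeightedHomogeneous w c₁ (weightedTotalDegree w c₁)) ∧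
      (∀ w ∈ ws, IsWeightedHomogeneous w c₂ (weightedTotalDegree w c₂)) ∧
      (∀ w ∈ ws, IsWeightedHomogeneous w (w₁ • c₁ + w₂ • c₂)
        (weightedTotalDegree w (w₁ • c₁ + w₂ • c₂))) := by
  obtain ⟨P, h2, hP, hsize, hH⟩ := exists_pruned_circuit ws g hhom
  have heval : P.output.eval ((gateValues P.gates).take P.size) = g := by
    rw [List.take_of_length_le (by rw [gateValues_length]; rfl)]
    exact hP
  have hdeg : (P.output.eval ((gateValues P.gates).take P.size)).totalDegree ≤ g.totalDegree := by
    rw [heval]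
  rw [← heval] at hg hdvd
  obtain ⟨c₁, c₂, w₁, w₂, h⟩ := walkQ hn P h2
    (fun p => ∀ w ∈ ws, IsWeightedHomogeneous w p (weightedTotalDegree w p))
    (operand_eval_take_hom ws P hH) P.size P.output g.totalDegree hg hdvd hdeg
  rw [hsize] at h
  exact ⟨c₁, c₂, w₁, w₂, h⟩

end Summit.ValiantsHypothesis.ValiantsHypothesis.Theorems.DivisionGap.PerCofactorDegreeReduction.AdditiveCreationHomogeneous

end
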